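import Summits.BirchSwinnertonDyer.Rank1Residual.X12.CubeSumFamilies
import HarnessLib

/-!
# X12 at `p = 3`, cube-sum corner: the 13 beyond-window classes of the RAM3 census as kernel records

HONEST FRAMING (cell `b2b-bsdres`, run/shared/lean/b2b/bsd-rank1-residual/; harvest seat
`b2b-bsdres-harvest-1`, gen 24): prove what is provable now; shrink each hard class to its core
with data; no claim beyond stated classes. The cell deletes the COMBINATION-SHAPED residual classes
of the BSD formula in analytic rank `≤ 1` from PUBLISHED theorems only and TYPES the
construction-shaped ones; this is not "finishing BSD". Class X12 stays CONSTRUCTION-SHAPED (family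
theorems are per-curve tools, referee R65.1; no label change; nothing booked — the lane books).
Theorems only: NO new named fact, no definition of a notion (the thirteen `def`s are explicit
Weierstrass equations = data); net Literature debt `0`.

The planner census `HOME/b2b-bsdres-hyp/hyp/ram3/RAM3-CENSUS.md` §5 (two engines A ‖ P,
0 disagreements; VALUE-500K §15) lists 13 isogeny classes with `2·10⁴ ≤ N < 5·10⁵` in the X12 corner
CM-by-`ℚ(√−3)` ∧ `r = 1` ∧ `p = 3` whose rank-one member is an instance of a LANDED family fact with
every binder met: Hu–Shu–Yin `E_n`, `n = 31, 79, 97, 223`; Kezuka–Li `C_n`, `n = 2·23², 2·29, 2·41²,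
2·47, 2·59²`; Shu–Yin `E_n`, `n = 3·11², 3·23, 3·29², 3·41`. For each this file gives the integral
equation `[0, 0, a₃, 0, a₆]` `ℚ`-isomorphic to the printed one (`halfScale : (x, y) ↦ (x/4, y/8 − 1/2)`
for `y² + y = x³ + a₆ ≅ y² = x³ + 64a₆ + 16`, or the identity for Kezuka–Li's model (4.1)), its
`IsElliptic` and `IsGloballyMinimal` instances DECIDED in the kernel (gen 3's `isGloballyMinimal_mk`:
`b₆ = a₃² + 4a₆ ≠ 0`, `3⁶ ∤ b₆` so `3⁹ ∤ c₆` — the `3`-adic criterion for `c₄ = 0` —, `27 b₆² < 60¹²` and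
`checkTwelfth (27 b₆²) 60`, Silverman's `ord_q Δ < 12` at `q ≠ 3`), the printed side conditions on the
prime by `decide`, and **`r_an = 1 ∧ BSD(E, 3)` from the partner-free consumers of
`X12/CubeSumFamilies.lean`** (`bsdp_three_of_thm14'`, `bsdp_three_of_thm12_two'/five'`) and
`KezukaLi2020.bsdp_three_of_cor12` — no partner model, no instance hypothesis, no Cassels / GZK (each
record IS the family's own equation). Conductors / class labels in the docstrings are the census's and
this seat's PARI/GP re-computation (`HOME/b2b-bsdres-harvest-1/g24/cubesum_families/`), quoted for
orientation only; the theorems are about the explicit equations.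

## References
* [HuShuYin2019] Trans. AMS 372 (2019), Thm. 1.4, p. 4; [KezukaLi2020] Doc. Math. 25 (2020), Cor. 1.2,
  (4.1); [ShuYin2022] Math. Ann. 385 (2023), Thm. 1.2; [BurungaleFlach2024] Camb. J. Math. 12 (2024),
  Cor. 2; [SilvermanAEC2009] VII.1 Remark 1.1, VIII.8, III.1; [Miller2011LMS] Def. 1.1.
* HOME/b2b-bsdres-hyp/hyp/ram3/RAM3-CENSUS.md §4–§5; HOME/b2b-bsdres-harvest-1/RECLASSIFY.md §GEN-24.
-/

set_option autoImplicit false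

noncomputable section

open scoped Classical

open WeierstrassCurve Literature.NumberTheory.EllipticCurves
  Literature.NumberTheory.EllipticCurves.Rank1Residual
  Literature.NumberTheory.EllipticCurves.HuShuYin2019
  Literature.NumberTheory.EllipticCurves.Rank1Residual.X12CubeSum

namespace Summit.BirchSwinnertonDyer.Rank1Residual.X12.CubeSumFamilies

section HuShuYin

/-- `E_31 : x³ + y³ = 31` as `y² + y = x³ − 6487` (`64·(−6487) + 16 = −432·31²`); `N = 25947 = 3³·31²`,
class 25947a (hyp RAM3 §5). [cite: HuShuYin2019, p. 4] -/
def cubeSum31 : WeierstrassCurve ℚ := ⟨0, 0, 1, 0, -6487⟩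
/-- `E_79` as `y² + y = x³ − 42127`; `N = 56169 = 3²·79²`, class 56169a. [cite: HuShuYin2019, p. 4] -/
def cubeSum79 : WeierstrassCurve ℚ := ⟨0, 0, 1, 0, -42127⟩
/-- `E_97` as `y² + y = x³ − 63511`; `N = 84681 = 3²·97²`, class 84681b. [cite: HuShuYin2019, p. 4] -/
def cubeSum97 : WeierstrassCurve ℚ := ⟨0, 0, 1, 0, -63511⟩
/-- `E_223` as `y² + y = x³ − 335671`; `N = 447561 = 3²·223²`, class 447561c. [cite: HuShuYin2019, p. 4] -/
def cubeSum223 : WeierstrassCurve ℚ := ⟨0, 0, 1, 0, -335671⟩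

/-- `cubeSum31` is elliptic (`Δ = −27 b₆² ≠ 0`). [cite: SilvermanAEC2009, III.1] -/
instance isElliptic_cubeSum31 : cubeSum31.IsElliptic := isElliptic_mk (by norm_num)
/-- `cubeSum79` is elliptic (`Δ = −27 b₆² ≠ 0`). [cite: SilvermanAEC2009, III.1] -/
instance isElliptic_cubeSum79 : cubeSum79.IsElliptic := isElliptic_mk (by norm_num)
/-- `cubeSum97` is elliptic (`Δ = −27 b₆² ≠ 0`). [cite: SilvermanAEC2009, III.1] -/
instance isElliptic_cubeSum97 : cubeSum97.IsElliptic := isElliptic_mk (by norm_num)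
/-- `cubeSum223` is elliptic (`Δ = −27 b₆² ≠ 0`). [cite: SilvermanAEC2009, III.1] -/
instance isElliptic_cubeSum223 : cubeSum223.IsElliptic := isElliptic_mk (by norm_num)

/-- `[0,0,1,0,−6487]` is globally minimal (`Δ = −3⁹·31⁴`). [cite: SilvermanAEC2009, VII.1 Remark 1.1] -/
instance isGloballyMinimal_cubeSum31 : cubeSum31.IsGloballyMinimal := by
  have := isGloballyMinimal_mk 1 (-6487) 60 (by norm_num) (by norm_num) (by norm_num) (by decide)
  simpa [cubeSum31] using this
/-- `[0,0,1,0,−42127]` is globally minimal (`Δ = −3⁹·79⁴`). [cite: SilvermanAEC2009, VII.1 Remark 1.1] -/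
instance isGloballyMinimal_cubeSum79 : cubeSum79.IsGloballyMinimal := by
  have := isGloballyMinimal_mk 1 (-42127) 60 (by norm_num) (by norm_num) (by norm_num) (by decide)
  simpa [cubeSum79] using this
/-- `[0,0,1,0,−63511]` is globally minimal (`Δ = −3⁹·97⁴`). [cite: SilvermanAEC2009, VII.1 Remark 1.1] -/
instance isGloballyMinimal_cubeSum97 : cubeSum97.IsGloballyMinimal := by
  have := isGloballyMinimal_mk 1 (-63511) 60 (by norm_num) (by norm_num) (by norm_num) (by decide)
  simpa [cubeSum97] using this
/-- `[0,0,1,0,−335671]` is globally minimal (`Δ = −3⁹·223⁴`). [cite: SilvermanAEC2009, VII.1 Remark 1.1] -/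
instance isGloballyMinimal_cubeSum223 : cubeSum223.IsGloballyMinimal := by
  have := isGloballyMinimal_mk 1 (-335671) 60 (by norm_num) (by norm_num) (by norm_num)
    (by decide)
  simpa [cubeSum223] using this

/-- The four equations are `ℚ`-isomorphic to `E_31`, `E_79`, `E_97`, `E_223` by `halfScale`.
[cite: HuShuYin2019, p. 4] -/
theorem cubeSum_hsy_eq :
    (∃ C : VariableChange ℚ, C • cubeSum31 = cubeSumCurve (31 : ℕ)) ∧
    (∃ C : VariableChange ℚ, C • cubeSum79 = cubeSumCurve (79 : ℕ)) ∧
    (∃ C : VariableChange ℚ, C • cubeSum97 = cubeSumCurve (97 : ℕ)) ∧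
    (∃ C : VariableChange ℚ, C • cubeSum223 = cubeSumCurve (223 : ℕ)) := by
  refine ⟨⟨halfScale, ?_⟩, ⟨halfScale, ?_⟩, ⟨halfScale, ?_⟩, ⟨halfScale, ?_⟩⟩ <;>
    simp only [cubeSum31, cubeSum79, cubeSum97, cubeSum223, halfScale_smul, cubeSumCurve] <;>
    norm_num

/-- The printed side conditions for `p = 31, 79, 97, 223`: `p ≡ 4` or `7 (mod 9)` and `3` is not a
cube modulo `p` (decided in the kernel; `decide +kernel` for the cubic residues, the
elaborator's `decide` exceeds `maxRecDepth` on `ZMod 79` and beyond). [cite: HuShuYin2019, Thm. 1.4 (hypotheses)] -/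
theorem hypotheses_hsy :
    ((31 % 9 = 4 ∨ 31 % 9 = 7) ∧ ¬ ∃ x : ZMod 31, x ^ 3 = 3) ∧
    ((79 % 9 = 4 ∨ 79 % 9 = 7) ∧ ¬ ∃ x : ZMod 79, x ^ 3 = 3) ∧
    ((97 % 9 = 4 ∨ 97 % 9 = 7) ∧ ¬ ∃ x : ZMod 97, x ^ 3 = 3) ∧
    ((223 % 9 = 4 ∨ 223 % 9 = 7) ∧ ¬ ∃ x : ZMod 223, x ^ 3 = 3) := by
  refine ⟨⟨by decide, by decide +kernel⟩, ⟨by decide, by decide +kernel⟩,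
    ⟨by decide, by decide +kernel⟩, ⟨by decide, by decide +kernel⟩⟩

/-- **`E_31` (class 25947a): `r_an = 1 ∧ BSD(E, 3)`** from Hu–Shu–Yin Thm. 1.4 + Burungale–Flach +
modularity; no partner model, no instance hypothesis. [cite: HuShuYin2019, Thm. 1.4] [cite: BurungaleFlach2024, Cor. 2] -/
theorem bsdp_three_cubeSum31 (hHSY : thm14_threePart_product)
    (hCM0 : bsdTriple_of_hasCM_of_L_one_ne_zero) (hmod : hasEntireLFunction_rat) :
    cubeSum31.analyticRank = 1 ∧ BSDp cubeSum31 3 := by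
  obtain ⟨hr, -, hb⟩ := bsdp_three_of_thm14' hHSY hCM0 hmod (p := 31) (by norm_num)
    hypotheses_hsy.1.1 hypotheses_hsy.1.2 cubeSum31 cubeSum_hsy_eq.1
  exact ⟨hr, hb⟩

/-- **`E_79` (class 56169a): `r_an = 1 ∧ BSD(E, 3)`.** [cite: HuShuYin2019, Thm. 1.4] [cite: BurungaleFlach2024, Cor. 2] -/
theorem bsdp_three_cubeSum79 (hHSY : thm14_threePart_product)
    (hCM0 : bsdTriple_of_hasCM_of_L_one_ne_zero) (hmod : hasEntireLFunction_rat) :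
    cubeSum79.analyticRank = 1 ∧ BSDp cubeSum79 3 := by
  obtain ⟨hr, -, hb⟩ := bsdp_three_of_thm14' hHSY hCM0 hmod (p := 79) (by norm_num)
    hypotheses_hsy.2.1.1 hypotheses_hsy.2.1.2 cubeSum79 cubeSum_hsy_eq.2.1
  exact ⟨hr, hb⟩

/-- **`E_97` (class 84681b): `r_an = 1 ∧ BSD(E, 3)`.** [cite: HuShuYin2019, Thm. 1.4] [cite: BurungaleFlach2024, Cor. 2] -/
theorem bsdp_three_cubeSum97 (hHSY : thm14_threePart_product)
    (hCM0 : bsdTriple_of_hasCM_of_L_one_ne_zero) (hmod : hasEntireLFunction_rat) :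
    cubeSum97.analyticRank = 1 ∧ BSDp cubeSum97 3 := by
  obtain ⟨hr, -, hb⟩ := bsdp_three_of_thm14' hHSY hCM0 hmod (p := 97) (by norm_num)
    hypotheses_hsy.2.2.1.1 hypotheses_hsy.2.2.1.2 cubeSum97 cubeSum_hsy_eq.2.2.1
  exact ⟨hr, hb⟩

/-- **`E_223` (class 447561c): `r_an = 1 ∧ BSD(E, 3)`.** [cite: HuShuYin2019, Thm. 1.4] [cite: BurungaleFlach2024, Cor. 2] -/
theorem bsdp_three_cubeSum223 (hHSY : thm14_threePart_product)
    (hCM0 : bsdTriple_of_hasCM_of_L_one_ne_zero) (hmod : hasEntireLFunction_rat) :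
    cubeSum223.analyticRank = 1 ∧ BSDp cubeSum223 3 := by
  obtain ⟨hr, -, hb⟩ := bsdp_three_of_thm14' hHSY hCM0 hmod (p := 223) (by norm_num)
    hypotheses_hsy.2.2.2.1 hypotheses_hsy.2.2.2.2 cubeSum223 cubeSum_hsy_eq.2.2.2
  exact ⟨hr, hb⟩

end HuShuYin

section KezukaLi

/-- `C_{1058} = C_{2·23²}` in Kezuka–Li's model (4.1): `y² = x³ − 27·23⁴`; `N = 57132 = 2²·3³·23²`,
class 57132b (hyp RAM3 §5). [cite: KezukaLi2020, (4.1) (p. 2139)] -/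
def cubeSum1058 : WeierstrassCurve ℚ := ⟨0, 0, 0, 0, -7555707⟩
/-- `C_{58} = C_{2·29}`: `y² = x³ − 27·29²`; `N = 90828 = 2²·3³·29²`, class 90828j. [cite: KezukaLi2020, (4.1) (p. 2139)] -/
def cubeSum58 : WeierstrassCurve ℚ := ⟨0, 0, 0, 0, -22707⟩
/-- `C_{3362} = C_{2·41²}`: `y² = x³ − 27·41⁴`; `N = 181548 = 2²·3³·41²`, class 181548i. [cite: KezukaLi2020, (4.1) (p. 2139)] -/
def cubeSum3362 : WeierstrassCurve ℚ := ⟨0, 0, 0, 0, -76295547⟩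
/-- `C_{94} = C_{2·47}`: `y² = x³ − 27·47²`; `N = 238572 = 2²·3³·47²`, class 238572i. [cite: KezukaLi2020, (4.1) (p. 2139)] -/
def cubeSum94 : WeierstrassCurve ℚ := ⟨0, 0, 0, 0, -59643⟩
/-- `C_{6962} = C_{2·59²}`: `y² = x³ − 27·59⁴`; `N = 375948 = 2²·3³·59²`, class 375948m. [cite: KezukaLi2020, (4.1) (p. 2139)] -/
def cubeSum6962 : WeierstrassCurve ℚ := ⟨0, 0, 0, 0, -327168747⟩

/-- `cubeSum1058` is elliptic (`Δ = −27 b₆² ≠ 0`). [cite: SilvermanAEC2009, III.1] -/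
instance isElliptic_cubeSum1058 : cubeSum1058.IsElliptic := isElliptic_mk (by norm_num)
/-- `cubeSum58` is elliptic (`Δ = −27 b₆² ≠ 0`). [cite: SilvermanAEC2009, III.1] -/
instance isElliptic_cubeSum58 : cubeSum58.IsElliptic := isElliptic_mk (by norm_num)
/-- `cubeSum3362` is elliptic (`Δ = −27 b₆² ≠ 0`). [cite: SilvermanAEC2009, III.1] -/
instance isElliptic_cubeSum3362 : cubeSum3362.IsElliptic := isElliptic_mk (by norm_num)
/-- `cubeSum94` is elliptic (`Δ = −27 b₆² ≠ 0`). [cite: SilvermanAEC2009, III.1] -/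
instance isElliptic_cubeSum94 : cubeSum94.IsElliptic := isElliptic_mk (by norm_num)
/-- `cubeSum6962` is elliptic (`Δ = −27 b₆² ≠ 0`). [cite: SilvermanAEC2009, III.1] -/
instance isElliptic_cubeSum6962 : cubeSum6962.IsElliptic := isElliptic_mk (by norm_num)

/-- `[0,0,0,0,−27·23⁴]` is globally minimal (`Δ = −2⁴·3⁹·23⁸`). [cite: SilvermanAEC2009, VII.1 Remark 1.1] -/
instance isGloballyMinimal_cubeSum1058 : cubeSum1058.IsGloballyMinimal := by
  have := isGloballyMinimal_mk 0 (-7555707) 60 (by norm_num) (by norm_num) (by norm_num)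
    (by decide)
  simpa [cubeSum1058] using this
/-- `[0,0,0,0,−27·29²]` is globally minimal (`Δ = −2⁴·3⁹·29⁴`). [cite: SilvermanAEC2009, VII.1 Remark 1.1] -/
instance isGloballyMinimal_cubeSum58 : cubeSum58.IsGloballyMinimal := by
  have := isGloballyMinimal_mk 0 (-22707) 60 (by norm_num) (by norm_num) (by norm_num) (by decide)
  simpa [cubeSum58] using this
/-- `[0,0,0,0,−27·41⁴]` is globally minimal (`Δ = −2⁴·3⁹·41⁸`). [cite: SilvermanAEC2009, VII.1 Remark 1.1] -/
instance isGloballyMinimal_cubeSum3362 : cubeSum3362.IsGloballyMinimal := by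
  have := isGloballyMinimal_mk 0 (-76295547) 60 (by norm_num) (by norm_num) (by norm_num)
    (by decide)
  simpa [cubeSum3362] using this
/-- `[0,0,0,0,−27·47²]` is globally minimal (`Δ = −2⁴·3⁹·47⁴`). [cite: SilvermanAEC2009, VII.1 Remark 1.1] -/
instance isGloballyMinimal_cubeSum94 : cubeSum94.IsGloballyMinimal := by
  have := isGloballyMinimal_mk 0 (-59643) 60 (by norm_num) (by norm_num) (by norm_num) (by decide)
  simpa [cubeSum94] using this
/-- `[0,0,0,0,−27·59⁴]` is globally minimal (`Δ = −2⁴·3⁹·59⁸`). [cite: SilvermanAEC2009, VII.1 Remark 1.1] -/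
instance isGloballyMinimal_cubeSum6962 : cubeSum6962.IsGloballyMinimal := by
  have := isGloballyMinimal_mk 0 (-327168747) 60 (by norm_num) (by norm_num) (by norm_num)
    (by decide)
  simpa [cubeSum6962] using this

/-- The five equations ARE Kezuka–Li's models (4.1) (variable change `1`).
[cite: KezukaLi2020, (4.1) (p. 2139)] -/
theorem cubeSum_kl_eq :
    (∃ C : VariableChange ℚ, C • cubeSum1058 = KezukaLi2020.cubeSumTwoModel 23 2) ∧
    (∃ C : VariableChange ℚ, C • cubeSum58 = KezukaLi2020.cubeSumTwoModel 29 1) ∧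
    (∃ C : VariableChange ℚ, C • cubeSum3362 = KezukaLi2020.cubeSumTwoModel 41 2) ∧
    (∃ C : VariableChange ℚ, C • cubeSum94 = KezukaLi2020.cubeSumTwoModel 47 1) ∧
    (∃ C : VariableChange ℚ, C • cubeSum6962 = KezukaLi2020.cubeSumTwoModel 59 2) := by
  refine ⟨⟨1, ?_⟩, ⟨1, ?_⟩, ⟨1, ?_⟩, ⟨1, ?_⟩, ⟨1, ?_⟩⟩ <;>
    simp only [one_smul, cubeSum1058, cubeSum58, cubeSum3362, cubeSum94, cubeSum6962,
      KezukaLi2020.cubeSumTwoModel] <;>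
    norm_num

/-- **`C_{1058}` (class 57132b): `r_an = 1 ∧ BSD(E, 3)`** from Kezuka–Li Cor. 1.2 (2) (`p = 23 ≡ 5 mod 9`).
[cite: KezukaLi2020, Cor. 1.2 (2)] -/
theorem bsdp_three_cubeSum1058 (hKL : KezukaLi2020.cor12_threePart_of_cubeSum) :
    cubeSum1058.analyticRank = 1 ∧ BSDp cubeSum1058 3 :=
  KezukaLi2020.bsdp_three_of_cor12 hKL (p := 23) (by norm_num) (by norm_num)
    (Or.inr ⟨by norm_num, rfl⟩) cubeSum1058 cubeSum_kl_eq.1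

/-- **`C_{58}` (class 90828j): `r_an = 1 ∧ BSD(E, 3)`** from Kezuka–Li Cor. 1.2 (1) (`p = 29 ≡ 2 mod 9`).
[cite: KezukaLi2020, Cor. 1.2 (1)] -/
theorem bsdp_three_cubeSum58 (hKL : KezukaLi2020.cor12_threePart_of_cubeSum) :
    cubeSum58.analyticRank = 1 ∧ BSDp cubeSum58 3 :=
  KezukaLi2020.bsdp_three_of_cor12 hKL (p := 29) (by norm_num) (by norm_num)
    (Or.inl ⟨by norm_num, rfl⟩) cubeSum58 cubeSum_kl_eq.2.1

/-- **`C_{3362}` (class 181548i): `r_an = 1 ∧ BSD(E, 3)`** from Kezuka–Li Cor. 1.2 (2) (`p = 41 ≡ 5 mod 9`).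
[cite: KezukaLi2020, Cor. 1.2 (2)] -/
theorem bsdp_three_cubeSum3362 (hKL : KezukaLi2020.cor12_threePart_of_cubeSum) :
    cubeSum3362.analyticRank = 1 ∧ BSDp cubeSum3362 3 :=
  KezukaLi2020.bsdp_three_of_cor12 hKL (p := 41) (by norm_num) (by norm_num)
    (Or.inr ⟨by norm_num, rfl⟩) cubeSum3362 cubeSum_kl_eq.2.2.1

/-- **`C_{94}` (class 238572i): `r_an = 1 ∧ BSD(E, 3)`** from Kezuka–Li Cor. 1.2 (1) (`p = 47 ≡ 2 mod 9`).
[cite: KezukaLi2020, Cor. 1.2 (1)] -/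
theorem bsdp_three_cubeSum94 (hKL : KezukaLi2020.cor12_threePart_of_cubeSum) :
    cubeSum94.analyticRank = 1 ∧ BSDp cubeSum94 3 :=
  KezukaLi2020.bsdp_three_of_cor12 hKL (p := 47) (by norm_num) (by norm_num)
    (Or.inl ⟨by norm_num, rfl⟩) cubeSum94 cubeSum_kl_eq.2.2.2.1

/-- **`C_{6962}` (class 375948m): `r_an = 1 ∧ BSD(E, 3)`** from Kezuka–Li Cor. 1.2 (2) (`p = 59 ≡ 5 mod 9`).
[cite: KezukaLi2020, Cor. 1.2 (2)] -/
theorem bsdp_three_cubeSum6962 (hKL : KezukaLi2020.cor12_threePart_of_cubeSum) :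
    cubeSum6962.analyticRank = 1 ∧ BSDp cubeSum6962 3 :=
  KezukaLi2020.bsdp_three_of_cor12 hKL (p := 59) (by norm_num) (by norm_num)
    (Or.inr ⟨by norm_num, rfl⟩) cubeSum6962 cubeSum_kl_eq.2.2.2.2

end KezukaLi

section ShuYin

/-- `E_{363} = E_{3·11²}` as `y² + y = x³ − 889441` (`64 a₆ + 16 = −432·363²`); `N = 29403 = 3⁵·11²`,
class 29403g (hyp RAM3 §5). [cite: ShuYin2022, Thm. 1.2] [cite: HuShuYin2019, p. 4] -/
def cubeSum363 : WeierstrassCurve ℚ := ⟨0, 0, 1, 0, -889441⟩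
/-- `E_{69} = E_{3·23}` as `y² + y = x³ − 32137`; `N = 128547 = 3⁵·23²`, class 128547o. [cite: ShuYin2022, Thm. 1.2] -/
def cubeSum69 : WeierstrassCurve ℚ := ⟨0, 0, 1, 0, -32137⟩
/-- `E_{2523} = E_{3·29²}` as `y² + y = x³ − 42967321`; `N = 204363 = 3⁵·29²`, class 204363e. [cite: ShuYin2022, Thm. 1.2] -/
def cubeSum2523 : WeierstrassCurve ℚ := ⟨0, 0, 1, 0, -42967321⟩
/-- `E_{123} = E_{3·41}` as `y² + y = x³ − 102121`; `N = 408483 = 3⁵·41²`, class 408483l. [cite: ShuYin2022, Thm. 1.2] -/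
def cubeSum123 : WeierstrassCurve ℚ := ⟨0, 0, 1, 0, -102121⟩

/-- `cubeSum363` is elliptic (`Δ = −27 b₆² ≠ 0`). [cite: SilvermanAEC2009, III.1] -/
instance isElliptic_cubeSum363 : cubeSum363.IsElliptic := isElliptic_mk (by norm_num)
/-- `cubeSum69` is elliptic (`Δ = −27 b₆² ≠ 0`). [cite: SilvermanAEC2009, III.1] -/
instance isElliptic_cubeSum69 : cubeSum69.IsElliptic := isElliptic_mk (by norm_num)
/-- `cubeSum2523` is elliptic (`Δ = −27 b₆² ≠ 0`). [cite: SilvermanAEC2009, III.1] -/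
instance isElliptic_cubeSum2523 : cubeSum2523.IsElliptic := isElliptic_mk (by norm_num)
/-- `cubeSum123` is elliptic (`Δ = −27 b₆² ≠ 0`). [cite: SilvermanAEC2009, III.1] -/
instance isElliptic_cubeSum123 : cubeSum123.IsElliptic := isElliptic_mk (by norm_num)

/-- `[0,0,1,0,−889441]` is globally minimal (`Δ = −3¹³·11⁸`; at `3` by the `3`-adic criterion,
`ord₃ c₆ = 8`). [cite: SilvermanAEC2009, VII.1] -/
instance isGloballyMinimal_cubeSum363 : cubeSum363.IsGloballyMinimal := by
  have := isGloballyMinimal_mk 1 (-889441) 60 (by norm_num) (by norm_num) (by norm_num)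
    (by decide)
  simpa [cubeSum363] using this
/-- `[0,0,1,0,−32137]` is globally minimal (`Δ = −3¹³·23⁴`). [cite: SilvermanAEC2009, VII.1] -/
instance isGloballyMinimal_cubeSum69 : cubeSum69.IsGloballyMinimal := by
  have := isGloballyMinimal_mk 1 (-32137) 60 (by norm_num) (by norm_num) (by norm_num) (by decide)
  simpa [cubeSum69] using this
/-- `[0,0,1,0,−42967321]` is globally minimal (`Δ = −3¹³·29⁸`). [cite: SilvermanAEC2009, VII.1] -/
instance isGloballyMinimal_cubeSum2523 : cubeSum2523.IsGloballyMinimal := by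
  have := isGloballyMinimal_mk 1 (-42967321) 60 (by norm_num) (by norm_num) (by norm_num)
    (by decide)
  simpa [cubeSum2523] using this
/-- `[0,0,1,0,−102121]` is globally minimal (`Δ = −3¹³·41⁴`). [cite: SilvermanAEC2009, VII.1] -/
instance isGloballyMinimal_cubeSum123 : cubeSum123.IsGloballyMinimal := by
  have := isGloballyMinimal_mk 1 (-102121) 60 (by norm_num) (by norm_num) (by norm_num)
    (by decide)
  simpa [cubeSum123] using this

/-- The four equations are `ℚ`-isomorphic to `E_{3·11²}`, `E_{3·23}`, `E_{3·29²}`, `E_{3·41}` by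
`halfScale`. [cite: HuShuYin2019, p. 4] -/
theorem cubeSum_sy_eq :
    (∃ C : VariableChange ℚ, C • cubeSum363 = cubeSumCurve (3 * ((11 : ℕ) : ℚ) ^ 2)) ∧
    (∃ C : VariableChange ℚ, C • cubeSum69 = cubeSumCurve (3 * ((23 : ℕ) : ℚ))) ∧
    (∃ C : VariableChange ℚ, C • cubeSum2523 = cubeSumCurve (3 * ((29 : ℕ) : ℚ) ^ 2)) ∧
    (∃ C : VariableChange ℚ, C • cubeSum123 = cubeSumCurve (3 * ((41 : ℕ) : ℚ))) := by
  refine ⟨⟨halfScale, ?_⟩, ⟨halfScale, ?_⟩, ⟨halfScale, ?_⟩, ⟨halfScale, ?_⟩⟩ <;>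
    simp only [cubeSum363, cubeSum69, cubeSum2523, cubeSum123, halfScale_smul, cubeSumCurve] <;>
    norm_num

/-- **`E_{363}` (class 29403g): `r_an = 1 ∧ BSD(E, 3)`** from Shu–Yin Thm. 1.2 (`p = 11 ≡ 2 mod 9`) +
Burungale–Flach; no partner model. [cite: ShuYin2022, Thm. 1.2] [cite: BurungaleFlach2024, Cor. 2] -/
theorem bsdp_three_cubeSum363 (hSY : ShuYin2022.thm12_threePart_product)
    (hCM0 : bsdTriple_of_hasCM_of_L_one_ne_zero) (hmod : hasEntireLFunction_rat) :
    cubeSum363.analyticRank = 1 ∧ BSDp cubeSum363 3 :=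
  bsdp_three_of_thm12_two' hSY hCM0 hmod (p := 11) (by norm_num) (by norm_num) (by norm_num)
    cubeSum363 cubeSum_sy_eq.1

/-- **`E_{69}` (class 128547o): `r_an = 1 ∧ BSD(E, 3)`** from Shu–Yin Thm. 1.2 (`p = 23 ≡ 5 mod 9`) +
Burungale–Flach. [cite: ShuYin2022, Thm. 1.2] [cite: BurungaleFlach2024, Cor. 2] -/
theorem bsdp_three_cubeSum69 (hSY : ShuYin2022.thm12_threePart_product)
    (hCM0 : bsdTriple_of_hasCM_of_L_one_ne_zero) (hmod : hasEntireLFunction_rat) :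
    cubeSum69.analyticRank = 1 ∧ BSDp cubeSum69 3 :=
  bsdp_three_of_thm12_five' hSY hCM0 hmod (p := 23) (by norm_num) (by norm_num)
    cubeSum69 cubeSum_sy_eq.2.1

/-- **`E_{2523}` (class 204363e): `r_an = 1 ∧ BSD(E, 3)`** from Shu–Yin Thm. 1.2 (`p = 29 ≡ 2 mod 9`) +
Burungale–Flach. [cite: ShuYin2022, Thm. 1.2] [cite: BurungaleFlach2024, Cor. 2] -/
theorem bsdp_three_cubeSum2523 (hSY : ShuYin2022.thm12_threePart_product)
    (hCM0 : bsdTriple_of_hasCM_of_L_one_ne_zero) (hmod : hasEntireLFunction_rat) :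
    cubeSum2523.analyticRank = 1 ∧ BSDp cubeSum2523 3 :=
  bsdp_three_of_thm12_two' hSY hCM0 hmod (p := 29) (by norm_num) (by norm_num) (by norm_num)
    cubeSum2523 cubeSum_sy_eq.2.2.1

/-- **`E_{123}` (class 408483l): `r_an = 1 ∧ BSD(E, 3)`** from Shu–Yin Thm. 1.2 (`p = 41 ≡ 5 mod 9`) +
Burungale–Flach. [cite: ShuYin2022, Thm. 1.2] [cite: BurungaleFlach2024, Cor. 2] -/
theorem bsdp_three_cubeSum123 (hSY : ShuYin2022.thm12_threePart_product)
    (hCM0 : bsdTriple_of_hasCM_of_L_one_ne_zero) (hmod : hasEntireLFunction_rat) :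
    cubeSum123.analyticRank = 1 ∧ BSDp cubeSum123 3 :=
  bsdp_three_of_thm12_five' hSY hCM0 hmod (p := 41) (by norm_num) (by norm_num)
    cubeSum123 cubeSum_sy_eq.2.2.2

end ShuYin

/-- **Summary (the 13 beyond-window cube-sum classes of RAM3-CENSUS §5).** Given the three published
family theorems, Burungale–Flach 2024 Cor. 2 and modularity (all PUBLISHED named facts of the tree;
no Cassels and no Gross–Zagier–Kolyvagin needed since each record is the family's own equation),
`BSD(E, 3)` holds for the thirteen explicit curves `E_31, E_79, E_97, E_223` (Hu–Shu–Yin),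
`C_{1058}, C_{58}, C_{3362}, C_{94}, C_{6962}` (Kezuka–Li), `E_{363}, E_{69}, E_{2523}, E_{123}`
(Shu–Yin), with no instance hypothesis and no partner model. [cite: KezukaLi2020, Cor. 1.2] [cite: HuShuYin2019, Thm. 1.4] [cite: ShuYin2022, Thm. 1.2] [cite: BurungaleFlach2024, Cor. 2] -/
theorem bsdp_three_beyond_window_records (hKL : KezukaLi2020.cor12_threePart_of_cubeSum)
    (hHSY : thm14_threePart_product) (hSY : ShuYin2022.thm12_threePart_product)
    (hCM0 : bsdTriple_of_hasCM_of_L_one_ne_zero) (hmod : hasEntireLFunction_rat) :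
    BSDp cubeSum31 3 ∧ BSDp cubeSum79 3 ∧ BSDp cubeSum97 3 ∧ BSDp cubeSum223 3 ∧
    BSDp cubeSum1058 3 ∧ BSDp cubeSum58 3 ∧ BSDp cubeSum3362 3 ∧ BSDp cubeSum94 3 ∧
    BSDp cubeSum6962 3 ∧
    BSDp cubeSum363 3 ∧ BSDp cubeSum69 3 ∧ BSDp cubeSum2523 3 ∧ BSDp cubeSum123 3 :=
  ⟨(bsdp_three_cubeSum31 hHSY hCM0 hmod).2, (bsdp_three_cubeSum79 hHSY hCM0 hmod).2,
    (bsdp_three_cubeSum97 hHSY hCM0 hmod).2, (bsdp_three_cubeSum223 hHSY hCM0 hmod).2,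
    (bsdp_three_cubeSum1058 hKL).2, (bsdp_three_cubeSum58 hKL).2, (bsdp_three_cubeSum3362 hKL).2,
    (bsdp_three_cubeSum94 hKL).2, (bsdp_three_cubeSum6962 hKL).2,
    (bsdp_three_cubeSum363 hSY hCM0 hmod).2, (bsdp_three_cubeSum69 hSY hCM0 hmod).2,
    (bsdp_three_cubeSum2523 hSY hCM0 hmod).2, (bsdp_three_cubeSum123 hSY hCM0 hmod).2⟩

end Summit.BirchSwinnertonDyer.Rank1Residual.X12.CubeSumFamilies

end
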